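import Summits.QuantumFields.YangMills.Theorems.BalabanUVNodesN08AtRecord11
import Literature.MathematicalPhysics.QuantumFieldTheory.Balaban1983to89.Node00.CarriersB10Prime

/-!
# BalabanUVNodes ∕ N08 — THE PRIMED FACES: the SUPPLIER SOCKET of the primed [B10] slot `Node00.PrintedUV3V'` at an admissible averaging `𝔞` (chair R451 (R-b)'s
# count-path face), and N08's node sentence with the primed slot displayed as a SIDE FACE at the cumulative Stage-10 pin `IsRecordOfRecord₁₀CB10YZ` and at the
# four-pin Stage-11 key `IsRecordOfRecord₁₁CB10YZW` (Track A, DAG node N08 [Balaban1985UV3] CMP 102 (1985) 255, Thm 1 p. 257 (compact reading) + Thm 2 p. 272;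
# cluster K3; the module dag-lead's FAN-OUT v1.1∕v1.2 §N08 s1 names «in flight» (REACTIVATE №11); R134 fan-out seat `pub-ymgap-dag-n08-c` g2, 2026-08-26)

PROVENANCE.  §1 and §2 are seat `pub-ymgap-dag-n08-a` g7's draft `HOME/pub-ymgap-dag-n08-a/lean/BalabanUVNodesN08PrimedFaces.lean` (sha16 97f6cf75063d62a4, farm-clean
12:08Z 08-26, announced INBOX l.11805, never filed — its author fell silent), ADOPTED VERBATIM by this seat under the director's R134 rule «a seat whose row is done takes
the node's next row» (adoption notice INBOX l.12623); §3 is this seat's four-pin Stage-11 twin of §2.  DROPPED from the draft, SAID: its «axial lane excluded» section —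
`SU(N)` non-discrete at `1` for `N ≥ 2` and `¬ Node00.LoopLinearised N (LoopAverage.trivial (SU N))` — is node00-def g31's `Node00/CarriersB10Prime.lean` v1.1 §4
(`Node00.not_loopLinearised_trivial`, p444866) and is CITED here, not restated; its [B8]-keyed Stage-10 storey (`IsRecordOfRecord₁₀CB10YZWB8`) has no consumer in the
tree (the route reads Stage 11) and is not typed — the [B8]-keyed STAGE-11 primed faces are g0's `…N08AtRecord11Sides` §A.

HONEST FRAMING.  Count-neutral kernel bookkeeping BY NAME over LANDED modules: node00-def g31's `Node00.CarriersB10Prime` (`AvgFamily₃`, `TFamilyA₃`, `avOfLoop`,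
`LoopLinearised`, `AvgAdmissible₃`, `PrintedUV3V'`, `avgAdmissible₃_avOfPrint`, `printedUV3V'_of_printedUV3V` = R451 (C2)'s arrow, `printedUV3V'_of_printedUV3G`,
`not_loopLinearised_trivial`), dag-n08-a's `B10RunsOfRecord` v1.2 §9∕§9′ (`runObjects₀A`, `Backgrounds.ofAvg`, `printedUV3G_A_of_uniformLeafSystems`) and census twins
`N08AtRecord9CB10` (`printedUV3V_of_uniformLeafSystems_at`) ∕ `N08AtRecord10CB10YZ` (`b10_main_iff_residual_…`, `b10_main_iff_bundles_…`, `s_N08_iff₁₀CB10YZ`,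
`printedUV3V_of_s_N08_record₁₀CB10YZ`), and this seat's g0 `N08AtRecord11` (`b10_main_iff_residual_of_isRecordOfRecord₁₁CB10YZW`, `b10_main_iff_bundles_of_…`,
`s_N08_iff₁₁CB10YZW`, `printedUV3V_of_s_N08_record₁₁CB10YZW`).  NOT A DISCHARGE OF N08 and NOT A RE-POINT: the `b10` leaf of every record predicate still reads the slot
of record S1 = `Node00.PrintedUV3V N L` (R451 (C2)); the primed slot `Node00.PrintedUV3V' N L` — [Balaban1985UV3] Thm 1 (compact) ∧ Thm 2 with their printed ∃-prefix
along SOME admissible averaging of Bałaban's printed axiomatic class ([Balaban1987RG1] (0.4)–(0.9) p. 253, the (0.4)-SHAPE sub-class with a LINEARISED small-loop average,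
R454 rail (i)), SOME version of [Balaban1985Averaging] (10) along it, print's [B11] minimisers read AT it — is DISPLAYED AS A SIDE FACE, in ONE direction only: S1 ⇒ primed,
by g31's arrow.  THE CONVERSE `PrintedUV3V' → PrintedUV3V` IS NOT CLAIMED (the primed slot is the wider reading; R451 (D): after (R-b) the count still needs an (R-a)-type
re-proof along an admissible averaging or (R-c)-type new mathematics — other lineages' work; §1 is the socket such a proof would inhabit).  Nothing of Bałaban's asserted; no
`Node00.` name typed here; the d = 3 lattices of [B10] inside the d = 4 record, one finite torus per run at fixed spacing; nothing continuum ∕ ℝ³ ∕ ℝ⁴ ∕ infinite volume ∕ OS ∕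
mass gap ∕ Clay.  0 `sorry`, 0 `def`, 0 `instance`, standard axioms.  Filed `--supports` item K1 `StabilityBAtRecordR11e` (stmt-QuantumFields-19674) of route «BalabanUVNodes».

WHAT THIS FILE PROVES.
* §1 THE SUPPLIER SOCKET AT 𝔞 (the count-path face R451 (R-b) names) — `printedUV3V'_of_uniformLeafSystems_at (𝔞) (h𝔞) (𝔗)`: admissible ∃-constants with UNIFORM LEAF
  SYSTEMS on print's runs over `runObjects₀A N 𝔞 𝔗 (Backgrounds.ofAvg N L 𝔞)` — EXACTLY the antecedent of `B10RunsOfRecord.printedUV3G_A_of_uniformLeafSystems` — give the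
  primed slot, for ANY admissible averaging family `𝔞` and ANY version family `𝔗` of (10) along it (∃-introduction by g31's `printedUV3V'_of_printedUV3G`);
  `printedUV3V'_of_uniformLeafSystems_loop (ℰ) (hℰ) (𝔗)`: the same where the supplier NAMES ITS SMALL-LOOP AVERAGE `ℰ : LoopAverage (SU N)` and PROVES
  `Node00.LoopLinearised N ℰ` ([Balaban1987RG1] (0.8)), the averaging being the (0.4)-shape family `avOfLoop N L ℰ` (R454 rail (ii)); NO instance at the trivial `E ≡ 1`
  (the axial ∕ decimation averaging of the closed d = 3 lane) for `N ≥ 2`, by g31's `Node00.not_loopLinearised_trivial` (cited); and the S1 COROLLARY side by side —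
  `uniformLeafSystems_print_iff_at_avOfPrint` (`Iff.rfl`: the S1 supplier socket of `N08AtRecord9CB10` IS the primed socket at print's own member `𝔞 := avOfPrint N`) and
  `printedUV3V'_of_uniformLeafSystems_print (𝔗)` (the S1 supplier hypothesis gives the primed slot — through S1 and g31's arrow, CITED not re-proved).
* §2 THE NODE SENTENCE WITH THE PRIMED SLOT AS A SIDE FACE at the cumulative Stage-10 pin `IsRecordOfRecord₁₀CB10YZ` (n08-a's (P5); direction S1 ⇒ primed ONLY):
  `b10_main_imp_primed_of_isRecordOfRecord₁₀CB10YZ` (at one record, at its block size `L`, at every run: `Dag.B10_main → b8 → b9 → b11 → PrintedUV3V' N L`),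
  `b10_main_imp_primed_bundles_of_isRecordOfRecord₁₀CB10YZ` (the same through the PINNED [B9] ∕ [B11] bundle leaves), `s_N08_record₁₀CB10YZ_imp_primed` (the ∀-sentence
  `S_N08 (₁₀CB10YZ)` implies its primed reading) and `printedUV3V'_of_s_N08_record₁₀CB10YZ` (under inhabitation the closer of record reads the PRIMED slot back too).
* §3 THE SAME FOUR AT THE FOUR-PIN STAGE-11 KEY `IsRecordOfRecord₁₁CB10YZW` (node00-def g31's `Record11Carriers`; the key of the route's K-items is Stage 11) over g0's
  `N08AtRecord11` faces: `b10_main_imp_primed_of_isRecordOfRecord₁₁CB10YZW`, `b10_main_imp_primed_bundles_of_isRecordOfRecord₁₁CB10YZW` (θ : `Stage11Params`),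
  `s_N08_record₁₁CB10YZW_imp_primed`, `printedUV3V'_of_s_N08_record₁₁CB10YZW`.
  WHAT §2∕§3 CANNOT DISPLAY (said, not typed): a primed CLOSER — `S_N08 Rec` from `∀ L, Odd L → 1 < L → PrintedUV3V' N L` — needs a record predicate whose `b10` leaf reads
  the primed slot; no such predicate exists (R451 (C2): no re-point until worded; the re-key is the definer lineage's), so none is stated.
-/

noncomputable section

namespace Summit.QuantumFields.YangMills.BalabanUVNodes.N08PrimedFaces

open Literature.MathematicalPhysics.QuantumFieldTheory.Balaban1983to89
open Literature.MathematicalPhysics.QuantumFieldTheory.Balaban1983to89.T4Continuum (T4Family FiniteEpsData)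
open Literature.MathematicalPhysics.QuantumFieldTheory.Balaban1983to89.DagBinding (WorldP leavesP B9LeafX B11Leaf)
open Literature.MathematicalPhysics.QuantumFieldTheory.Balaban1983to89.Node00
open Literature.MathematicalPhysics.QuantumFieldTheory.Balaban1983to89.B10RunsOfRecord
  (Consts UniformLeafSystemsG PrintedUV3G runObjects₀T runObjects₀A Backgrounds avOfPrint printedUV3G_A_of_uniformLeafSystems)
open YMDAG.UVSplit (RecordPred Datum AtRecord S_N08)
open Summit.QuantumFields.YangMills.BalabanUVNodes.N08AtRecord9CB10 (printedUV3V_of_uniformLeafSystems_at)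
open Summit.QuantumFields.YangMills.BalabanUVNodes.N08AtRecord10CB10YZ
  (printedUV3V_of_s_N08_record₁₀CB10YZ b10_main_iff_residual_of_isRecordOfRecord₁₀CB10YZ b10_main_iff_bundles_of_isRecordOfRecord₁₀CB10YZ s_N08_iff₁₀CB10YZ)
open Summit.QuantumFields.YangMills.BalabanUVNodes.N08AtRecord11
  (printedUV3V_of_s_N08_record₁₁CB10YZW b10_main_iff_residual_of_isRecordOfRecord₁₁CB10YZW b10_main_iff_bundles_of_isRecordOfRecord₁₁CB10YZW s_N08_iff₁₁CB10YZW)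

variable {N : ℕ} [NeZero N]

/-! ## §1 THE SUPPLIER SOCKET AT AN ADMISSIBLE AVERAGING `𝔞` (R451 (R-b)'s count-path face), with the S1 corollary side by side -/

section Supplier

variable {L : ℕ}

/-- **THE SUPPLIER FACE OF THE PRIMED SLOT AT `𝔞`**: for ANY admissible averaging family `𝔞` of print's class (`Node00.AvgAdmissible₃`: the (0.4)-shape family of a
small-loop average satisfying [Balaban1987RG1] (0.8)) and ANY version family `𝔗` of (10) along it, admissible ∃-constants with UNIFORM LEAF SYSTEMS on print's runs over
`runObjects₀A N 𝔞 𝔗 (Backgrounds.ofAvg N L 𝔞)` (print's binders with `Ū := 𝔞`, `T := 𝔗`, print's [B11] minimisers READ AT `𝔞`) — EXACTLY the antecedent of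
`B10RunsOfRecord.printedUV3G_A_of_uniformLeafSystems` there — give `Node00.PrintedUV3V' N L`.  Usage: `printedUV3V'_of_uniformLeafSystems_at 𝔞 h𝔞 𝔗 ⟨c, hc, h⟩`.  This is
the socket a lane END theorem proved ALONG AN ADMISSIBLE AVERAGING would inhabit (R451 (C3): its in-edge faces read AT `𝔞`); NOT inhabited here.
[cite: Balaban1985UV3, Thm 1 p.257, Thm 2 p.272, Sect. D pp.272–275, p.256 L10; Balaban1987RG1, (0.4)–(0.9) p.253; Balaban1985Averaging, (10)–(11) p.19] -/
theorem printedUV3V'_of_uniformLeafSystems_at (𝔞 : AvgFamily₃ N L) (h𝔞 : AvgAdmissible₃ N 𝔞) (𝔗 : TFamilyA₃ N 𝔞)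
    (h : ∃ c : Consts L, c.Adm ∧ UniformLeafSystemsG N (runObjects₀A N 𝔞 𝔗 (Backgrounds.ofAvg N L 𝔞)) c) : PrintedUV3V' N L :=
  printedUV3V'_of_printedUV3G h𝔞 𝔗 (printedUV3G_A_of_uniformLeafSystems N L 𝔞 𝔗 (Backgrounds.ofAvg N L 𝔞) h)

/-- **THE SUPPLIER FACE WHERE THE SUPPLIER NAMES ITS SMALL-LOOP AVERAGE** (R454 rail (ii): «a supplier at the primed slot names its `ℰ` and proves `LoopLinearised N ℰ`»):
for a small-loop average `ℰ : LoopAverage (SU N)` ((0.5)–(0.7), (0.9) by type) satisfying [Balaban1987RG1] (0.8) (`Node00.LoopLinearised N ℰ`), ANY version family `𝔗`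
of (10) along its (0.4)-shape averaging family `Node00.avOfLoop N L ℰ`, and admissible ∃-constants with uniform leaf systems on print's runs over those binders,
`Node00.PrintedUV3V' N L` (admissibility witness `⟨ℰ, hℰ, rfl⟩`).  Print's own `exp[mean log]` is such an `ℰ` (g31's `loopLinearised_expMeanLogSU`); the TRIVIAL `E ≡ 1`
(axial ∕ decimation lane) is NOT, for `N ≥ 2` (g31's `Node00.not_loopLinearised_trivial`, `CarriersB10Prime` v1.1 §4 — cited, not restated).
[cite: Balaban1987RG1, (0.4)–(0.9) p.253, p.254; Balaban1985UV3, Thm 1 p.257, Thm 2 p.272, Sect. D pp.272–275] -/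
theorem printedUV3V'_of_uniformLeafSystems_loop (ℰ : LoopAverage (SU N)) (hℰ : LoopLinearised N ℰ) (𝔗 : TFamilyA₃ N (avOfLoop N L ℰ))
    (h : ∃ c : Consts L, c.Adm ∧ UniformLeafSystemsG N (runObjects₀A N (avOfLoop N L ℰ) 𝔗 (Backgrounds.ofAvg N L (avOfLoop N L ℰ))) c) :
    PrintedUV3V' N L :=
  printedUV3V'_of_uniformLeafSystems_at (avOfLoop N L ℰ) ⟨ℰ, hℰ, rfl⟩ 𝔗 h

/-- **THE S1 SUPPLIER SOCKET IS THE PRIMED SUPPLIER SOCKET AT PRINT'S OWN MEMBER** (`Iff.rfl` through dag-n08-a's v1.2 bridges `runObjects₀A_avOfPrint` ∕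
`Backgrounds.ofAvg_avOfPrint`): at `𝔞 := avOfPrint N` — admissible by g31's `avgAdmissible₃_avOfPrint` — and a version family `𝔗 : Node00.TFamily₃ N L` (`= TFamilyA₃ N (avOfPrint N)`,
`rfl`), the uniform-leaf-systems hypothesis over `runObjects₀A N (avOfPrint N) 𝔗 (Backgrounds.ofAvg N L (avOfPrint N))` IS the one over `runObjects₀T N 𝔗 (Backgrounds.ofPrint N L)`
of `N08AtRecord9CB10.printedUV3V_of_uniformLeafSystems_at`.  So nothing a future S1 supplier proves is lost at the primed slot. [cite: Balaban1985UV3, (2) p.256, Thm 1 p.257, Thm 2 p.272 (bookkeeping)] -/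
theorem uniformLeafSystems_print_iff_at_avOfPrint (𝔗 : TFamily₃ N L) :
    (∃ c : Consts L, c.Adm ∧ UniformLeafSystemsG N (runObjects₀A N (avOfPrint N) 𝔗 (Backgrounds.ofAvg N L (avOfPrint N))) c) ↔
      ∃ c : Consts L, c.Adm ∧ UniformLeafSystemsG N (runObjects₀T N 𝔗 (Backgrounds.ofPrint N L)) c :=
  Iff.rfl

/-- **THE S1 COROLLARY** (displayed beside the face at `𝔞`): the S1 supplier hypothesis of `N08AtRecord9CB10.printedUV3V_of_uniformLeafSystems_at` — uniform leaf systems on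
print's runs over `runObjects₀T N 𝔗 (Backgrounds.ofPrint N L)` at ANY version `𝔗` of print's transformations along print's OWN averaging — gives the PRIMED slot, through the
slot of record and R451 (C2)'s arrow `Node00.printedUV3V'_of_printedUV3V` (g31's; CITED, not re-proved).  Equivalently `printedUV3V'_of_uniformLeafSystems_at (avOfPrint N)
(avgAdmissible₃_avOfPrint N L) 𝔗 h` (same hypothesis by `uniformLeafSystems_print_iff_at_avOfPrint`). [cite: Balaban1985UV3, Thm 1 p.257, Thm 2 p.272, Sect. D pp.272–275 (bookkeeping)] -/
theorem printedUV3V'_of_uniformLeafSystems_print (𝔗 : TFamily₃ N L)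
    (h : ∃ c : Consts L, c.Adm ∧ UniformLeafSystemsG N (runObjects₀T N 𝔗 (Backgrounds.ofPrint N L)) c) : PrintedUV3V' N L :=
  printedUV3V'_of_printedUV3V N L (printedUV3V_of_uniformLeafSystems_at 𝔗 h)

end Supplier

/-! ## §2 THE NODE SENTENCE WITH THE PRIMED SLOT AS A SIDE FACE at the cumulative Stage-10 pin — direction S1 ⇒ primed ONLY (R451 (C2): no record predicate's `b10` is
re-pointed; the converse is NOT claimed) -/

section Record10CB10YZ

variable {F : T4Family} {D : Datum F N} {w : WorldP}

/-- **N08 at a ₁₀CB10YZ record IMPLIES ITS PRIMED READING** (side face, one direction): with `L` the world's block size, at every run `Dag.B10_main (leavesP w P)` gives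
«`b8 → b9 → b11 → Node00.PrintedUV3V' N L`» — the residual reading of `N08AtRecord10CB10YZ.b10_main_iff_residual_of_isRecordOfRecord₁₀CB10YZ` followed by g31's arrow.  The
converse («primed reading ⇒ `Dag.B10_main`») is NOT claimed: the leaf `b10` reads S1. [cite: Balaban1985UV3, Thm 1 p.257 (compact reading) and Thm 2 p.272 (bookkeeping)] -/
theorem b10_main_imp_primed_of_isRecordOfRecord₁₀CB10YZ (h : IsRecordOfRecord₁₀CB10YZ F N D w) :
    ∃ L : ℕ, (Odd L ∧ 1 < L) ∧ w.L = (L : ℝ) ∧ ∀ P : B12.RunParams,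
      Dag.B10_main (leavesP w P) → (leavesP w P).b8 → (leavesP w P).b9 → (leavesP w P).b11 → PrintedUV3V' N L := by
  obtain ⟨L, hL, hwL, hiff⟩ := b10_main_iff_residual_of_isRecordOfRecord₁₀CB10YZ h
  exact ⟨L, hL, hwL, fun P H h8 h9 h11 => printedUV3V'_of_printedUV3V N L ((hiff P).1 H h8 h9 h11)⟩

/-- **… THROUGH THE PINNED BUNDLES** (side face, one direction): for one parameter package `(θ, Mstar, ops, ζ)` presenting the record, at every run `Dag.B10_main (leavesP w P)`
gives «`b8 → B9LeafX (Y9OfRecord N θ₃ Mstar ops) → B11Leaf (Z11OfRecord F N ζ) → Node00.PrintedUV3V' N θ.L`» (`b10_main_iff_bundles_of_isRecordOfRecord₁₀CB10YZ` + g31's arrow).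
[cite: Balaban1985UV3, Thm 1 p.257 + Thm 2 p.272; Balaban1985BackgroundPropagators, Thm 3.1 p.397; Balaban1985Variational, Thm 1 p.279 (the pinned in-edge objects; bookkeeping)] -/
theorem b10_main_imp_primed_bundles_of_isRecordOfRecord₁₀CB10YZ (h : IsRecordOfRecord₁₀CB10YZ F N D w) :
    ∃ (θ : Stage9Params F N) (Mstar : ℕ) (ops : OpsY N θ.toStage3Params Mstar) (ζ : ResidZ F N), θ.Admissible ∧ w.L = (θ.L : ℝ) ∧
      ∀ P : B12.RunParams,
        Dag.B10_main (leavesP w P) →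
          (leavesP w P).b8 → B9LeafX (Y9OfRecord N θ.toStage3Params Mstar ops) → B11Leaf (Z11OfRecord F N ζ) → PrintedUV3V' N θ.L := by
  obtain ⟨θ, Mstar, ops, ζ, hθ, hL, hiff⟩ := b10_main_iff_bundles_of_isRecordOfRecord₁₀CB10YZ h
  exact ⟨θ, Mstar, ops, ζ, hθ, hL, fun P H h8 h9 h11 => printedUV3V'_of_printedUV3V N θ.L ((hiff P).1 H h8 h9 h11)⟩

/-- **THE ∀-SENTENCE OF RECORD IMPLIES ITS PRIMED READING** (side face, one direction): `S_N08 (IsRecordOfRecord₁₀CB10YZ F N)` ⇒ «at every ₁₀CB10YZ record, at its block size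
`L`, at every run where the residual in-edges `b8 b9 b11` hold, the PRIMED slot `Node00.PrintedUV3V' N L`» (`s_N08_iff₁₀CB10YZ` + g31's arrow).  The converse is NOT
claimed. [cite: Balaban1985UV3, Thm 1 p.257 (compact reading) and Thm 2 p.272 (bookkeeping)] -/
theorem s_N08_record₁₀CB10YZ_imp_primed (hS : S_N08 (fun F D w => IsRecordOfRecord₁₀CB10YZ F N D w)) :
    ∀ (F : T4Family) (D : Datum F N) (w : WorldP), IsRecordOfRecord₁₀CB10YZ F N D w → ∀ L : ℕ, w.L = (L : ℝ) →
      ∀ P : B12.RunParams, (leavesP w P).b8 → (leavesP w P).b9 → (leavesP w P).b11 → PrintedUV3V' N L :=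
  fun F D w h L hL P h8 h9 h11 => printedUV3V'_of_printedUV3V N L (s_N08_iff₁₀CB10YZ.1 hS F D w h L hL P h8 h9 h11)

/-- **Under inhabitation the ∀-form closer of record reads the PRIMED slot back too**: if `S_N08` holds at the cumulative Stage-10 pin and some ₁₀CB10YZ record on some
family has block size `L` and a run at which `b8 b9 b11` hold, then `Node00.PrintedUV3V' N L` HOLDS (`printedUV3V_of_s_N08_record₁₀CB10YZ` + g31's arrow).
[cite: Balaban1985UV3, Thm 1 p.257 (compact reading) and Thm 2 p.272 (bookkeeping)] -/
theorem printedUV3V'_of_s_N08_record₁₀CB10YZ (hS : S_N08 (fun F D w => IsRecordOfRecord₁₀CB10YZ F N D w))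
    (h : IsRecordOfRecord₁₀CB10YZ F N D w) {L : ℕ} (hL : w.L = (L : ℝ))
    {P : B12.RunParams} (h8 : (leavesP w P).b8) (h9 : (leavesP w P).b9) (h11 : (leavesP w P).b11) : PrintedUV3V' N L :=
  printedUV3V'_of_printedUV3V N L (printedUV3V_of_s_N08_record₁₀CB10YZ hS h hL h8 h9 h11)

end Record10CB10YZ

/-! ## §3 THE NODE SENTENCE WITH THE PRIMED SLOT AS A SIDE FACE at the four-pin Stage-11 key `IsRecordOfRecord₁₁CB10YZW` (the stage the route's K-items read) —
direction S1 ⇒ primed ONLY; the [B8]-keyed Stage-11 twins are g0's `N08AtRecord11Sides` §A -/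

section Record11CB10YZW

variable {F : T4Family} {D : Datum F N} {w : WorldP}

/-- **N08 at a four-pin ₁₁CB10YZW record IMPLIES ITS PRIMED READING** (side face, one direction): with `L` the world's block size, at every run `Dag.B10_main (leavesP w P)`
gives «`b8 → b9 → b11 → Node00.PrintedUV3V' N L`» — g0's residual reading `N08AtRecord11.b10_main_iff_residual_of_isRecordOfRecord₁₁CB10YZW` followed by g31's arrow.  The
converse is NOT claimed: the leaf `b10` reads S1. [cite: Balaban1985UV3, Thm 1 p.257 (compact reading) and Thm 2 p.272 (bookkeeping)] -/
theorem b10_main_imp_primed_of_isRecordOfRecord₁₁CB10YZW (h : IsRecordOfRecord₁₁CB10YZW F N D w) :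
    ∃ L : ℕ, (Odd L ∧ 1 < L) ∧ w.L = (L : ℝ) ∧ ∀ P : B12.RunParams,
      Dag.B10_main (leavesP w P) → (leavesP w P).b8 → (leavesP w P).b9 → (leavesP w P).b11 → PrintedUV3V' N L := by
  obtain ⟨L, hL, hwL, hiff⟩ := b10_main_iff_residual_of_isRecordOfRecord₁₁CB10YZW h
  exact ⟨L, hL, hwL, fun P H h8 h9 h11 => printedUV3V'_of_printedUV3V N L ((hiff P).1 H h8 h9 h11)⟩

/-- **… THROUGH THE PINNED STAGE-11 BUNDLES** (side face, one direction): for one Stage-11 package `(θ, Mstar, ops, ζ)` presenting the record, at every run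
`Dag.B10_main (leavesP w P)` gives «`b8 → B9LeafX (Y9OfRecord N θ₃ Mstar ops) → B11Leaf (Z11OfRecord F N ζ) → Node00.PrintedUV3V' N θ.L`» (g0's
`b10_main_iff_bundles_of_isRecordOfRecord₁₁CB10YZW` + g31's arrow).
[cite: Balaban1985UV3, Thm 1 p.257 + Thm 2 p.272; Balaban1985BackgroundPropagators, Thm 3.1 p.397; Balaban1985Variational, Thm 1 p.279 (the pinned in-edge objects; bookkeeping)] -/
theorem b10_main_imp_primed_bundles_of_isRecordOfRecord₁₁CB10YZW (h : IsRecordOfRecord₁₁CB10YZW F N D w) :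
    ∃ (θ : Stage11Params F N) (Mstar : ℕ) (ops : OpsY N θ.toStage3Params Mstar) (ζ : ResidZ F N), θ.Admissible ∧ w.L = (θ.L : ℝ) ∧
      ∀ P : B12.RunParams,
        Dag.B10_main (leavesP w P) →
          (leavesP w P).b8 → B9LeafX (Y9OfRecord N θ.toStage3Params Mstar ops) → B11Leaf (Z11OfRecord F N ζ) → PrintedUV3V' N θ.L := by
  obtain ⟨θ, Mstar, ops, ζ, hθ, hL, hiff⟩ := b10_main_iff_bundles_of_isRecordOfRecord₁₁CB10YZW h
  exact ⟨θ, Mstar, ops, ζ, hθ, hL, fun P H h8 h9 h11 => printedUV3V'_of_printedUV3V N θ.L ((hiff P).1 H h8 h9 h11)⟩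

/-- **THE FOUR-PIN STAGE-11 ∀-SENTENCE IMPLIES ITS PRIMED READING** (side face, one direction): `S_N08 (IsRecordOfRecord₁₁CB10YZW F N)` ⇒ «at every such record, at its
block size `L`, at every run where `b8 b9 b11` hold, `Node00.PrintedUV3V' N L`» (g0's `s_N08_iff₁₁CB10YZW` + g31's arrow).  The converse is NOT claimed.
[cite: Balaban1985UV3, Thm 1 p.257 (compact reading) and Thm 2 p.272 (bookkeeping)] -/
theorem s_N08_record₁₁CB10YZW_imp_primed (hS : S_N08 (fun F D w => IsRecordOfRecord₁₁CB10YZW F N D w)) :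
    ∀ (F : T4Family) (D : Datum F N) (w : WorldP), IsRecordOfRecord₁₁CB10YZW F N D w → ∀ L : ℕ, w.L = (L : ℝ) →
      ∀ P : B12.RunParams, (leavesP w P).b8 → (leavesP w P).b9 → (leavesP w P).b11 → PrintedUV3V' N L :=
  fun F D w h L hL P h8 h9 h11 => printedUV3V'_of_printedUV3V N L (s_N08_iff₁₁CB10YZW.1 hS F D w h L hL P h8 h9 h11)

/-- **Under inhabitation the four-pin Stage-11 closer of record reads the PRIMED slot back too**: if `S_N08` holds at ₁₁CB10YZW and some such record on some family has block
size `L` and a run at which `b8 b9 b11` hold, then `Node00.PrintedUV3V' N L` HOLDS (g0's `printedUV3V_of_s_N08_record₁₁CB10YZW` + g31's arrow).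
[cite: Balaban1985UV3, Thm 1 p.257 (compact reading) and Thm 2 p.272 (bookkeeping)] -/
theorem printedUV3V'_of_s_N08_record₁₁CB10YZW (hS : S_N08 (fun F D w => IsRecordOfRecord₁₁CB10YZW F N D w))
    (h : IsRecordOfRecord₁₁CB10YZW F N D w) {L : ℕ} (hL : w.L = (L : ℝ))
    {P : B12.RunParams} (h8 : (leavesP w P).b8) (h9 : (leavesP w P).b9) (h11 : (leavesP w P).b11) : PrintedUV3V' N L :=
  printedUV3V'_of_printedUV3V N L (printedUV3V_of_s_N08_record₁₁CB10YZW hS h hL h8 h9 h11)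

end Record11CB10YZW

end Summit.QuantumFields.YangMills.BalabanUVNodes.N08PrimedFaces

end
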